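import Mathlib.Analysis.SpecialFunctions.BinaryEntropy
import Mathlib.Analysis.Complex.ExponentialBounds
import Mathlib.Analysis.Convex.Deriv
import Literature.InformationTheory.Coding.SourcePolarizationStep
import HarnessLib

/-!
# One step of source polarization, II: the two binary-entropy inequalities

Theorem-only companion of `Literature/InformationTheory/Coding/SourcePolarizationStep.lean`:
the pointwise (one output `y` at a time) inequalities behind Arıkan's relations
`Z(X|Y)² ≤ H(X|Y) ≤ log₂(1 + Z(X|Y))` [Arıkan 2010, Prop. 2], stated for the un-normalised
binary entropy `pairEnt a b = a log₂((a+b)/a) + b log₂((a+b)/b) = (a+b) h₂(a/(a+b))` of a pair of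
counts:

* `four_mul_log_two_mul_le_binEntropy` — `h(p) ≥ 4 p (1 − p)` bits, i.e.
  `4 log 2 · p(1−p) ≤ binEntropy p` (nats), from the calculus lemma `polarAux_nonneg`:
  `(1+t) log(1+t) + (1−t) log(1−t) ≤ 2 log 2 · t²` on `[0, 1]` (convex on `[0, t*]` with vanishing
  value and slope at `0`, concave on `[t*, 1]` with nonnegative endpoint values,
  `t*² = 1 − 1/(2 log 2)`);
* `four_mul_div_le_pairEnt` — `4ab/(a+b) ≤ pairEnt a b` (the same, un-normalised);
* `pairEnt_le_mul_logb` — `pairEnt a b ≤ (a+b) log₂(1 + 2√(ab)/(a+b))`, i.e.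
  `h(p) ≤ log₂(1 + 2√(p(1−p)))` (Shannon entropy ≤ Rényi entropy of order `1/2`; two-point Jensen
  for `log`), and its consequence `pairEnt_le_add` — `pairEnt a b ≤ a + b` (`h ≤ 1`).

## References

* E. Arıkan, *Source polarization*, Proc. IEEE ISIT 2010, Prop. 2.  bib `Arikan2010`.
* T. M. Cover, J. A. Thomas, *Elements of Information Theory*, 2nd ed., 2006, Thm 2.6.4.
-/

noncomputable section

namespace Literature.InformationTheory.Coding.Polar

open Real Set

/-! ### The calculus lemma -/

/-- `1/2 < log 2`. [folklore] -/
theorem half_lt_log_two : (1 : ℝ) / 2 < Real.log 2 := by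
  have := Real.log_two_gt_d9
  linarith

/-- **The calculus lemma behind `h(p) ≥ 4p(1−p)`**: for `t ∈ [0, 1]`,
`(1+t) log(1+t) + (1−t) log(1−t) ≤ 2 log 2 · t²` (equality at `t = 0` and `t = 1`).  The
difference `D` has `D'' = 4 log 2 − 2/(1−t²)`, so `D` is convex on `[0, t*]` (`t*² = 1 − 1/(2 log 2)`),
where it lies above its tangent at `0` (which vanishes), and concave on `[t*, 1]`, where it lies
above the minimum of its endpoint values `D(t*) ≥ 0`, `D(1) = 0`. [folklore] -/
theorem polarAux_nonneg {t : ℝ} (h0 : 0 ≤ t) (h1 : t ≤ 1) :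
    0 ≤ 2 * Real.log 2 * t ^ 2 - ((1 + t) * Real.log (1 + t) + (1 - t) * Real.log (1 - t)) := by
  have hc : (1 : ℝ) / 2 < Real.log 2 := half_lt_log_two
  have hc0 : 0 < Real.log 2 := by linarith
  -- the function and its first two derivatives
  let D : ℝ → ℝ := fun t =>
    2 * Real.log 2 * t ^ 2 - ((1 + t) * Real.log (1 + t) + (1 - t) * Real.log (1 - t))
  let D1 : ℝ → ℝ := fun t => 4 * Real.log 2 * t - Real.log (1 + t) + Real.log (1 - t)
  let D2 : ℝ → ℝ := fun t => 4 * Real.log 2 - (1 + t)⁻¹ - (1 - t)⁻¹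
  show 0 ≤ D t
  have hderiv : ∀ x : ℝ, -1 < x → x < 1 → HasDerivAt D (D1 x) x := by
    intro x hx1 hx2
    have ha : HasDerivAt (fun x : ℝ => 1 + x) 1 x := (hasDerivAt_id x).const_add 1
    have hb : HasDerivAt (fun x : ℝ => 1 - x) (-1) x := (hasDerivAt_id x).const_sub 1
    have hpos1 : (0 : ℝ) < 1 + x := by linarith
    have hpos2 : (0 : ℝ) < 1 - x := by linarith
    have hla : HasDerivAt (fun x : ℝ => Real.log (1 + x)) (1 / (1 + x)) x := ha.log hpos1.ne'
    have hlb : HasDerivAt (fun x : ℝ => Real.log (1 - x)) (-1 / (1 - x)) x := hb.log hpos2.ne'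
    have h : HasDerivAt
        (fun y : ℝ => 2 * Real.log 2 * y ^ 2 - ((1 + y) * Real.log (1 + y) + (1 - y) * Real.log (1 - y)))
        (2 * Real.log 2 * (↑(2 : ℕ) * x ^ (2 - 1)) - ((1 * Real.log (1 + x) + (1 + x) * (1 / (1 + x))) +
          (-1 * Real.log (1 - x) + (1 - x) * (-1 / (1 - x))))) x :=
      ((hasDerivAt_pow 2 x).const_mul (2 * Real.log 2)).sub ((ha.mul hla).add (hb.mul hlb))
    refine h.congr_deriv ?_
    simp only [D1]
    push_cast
    field_simp
    ring
  have hderiv2 : ∀ x : ℝ, -1 < x → x < 1 → HasDerivAt D1 (D2 x) x := by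
    intro x hx1 hx2
    have ha : HasDerivAt (fun x : ℝ => 1 + x) 1 x := (hasDerivAt_id x).const_add 1
    have hb : HasDerivAt (fun x : ℝ => 1 - x) (-1) x := (hasDerivAt_id x).const_sub 1
    have hpos1 : (0 : ℝ) < 1 + x := by linarith
    have hpos2 : (0 : ℝ) < 1 - x := by linarith
    have hla : HasDerivAt (fun x : ℝ => Real.log (1 + x)) (1 / (1 + x)) x := ha.log hpos1.ne'
    have hlb : HasDerivAt (fun x : ℝ => Real.log (1 - x)) (-1 / (1 - x)) x := hb.log hpos2.ne'
    have h : HasDerivAt (fun y : ℝ => 4 * Real.log 2 * y - Real.log (1 + y) + Real.log (1 - y))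
        (4 * Real.log 2 * 1 - 1 / (1 + x) + -1 / (1 - x)) x :=
      (((hasDerivAt_id x).const_mul (4 * Real.log 2)).sub hla).add hlb
    refine h.congr_deriv ?_
    simp only [D2]
    field_simp
    ring
  have hcont : Continuous D := by
    have h1 : Continuous fun t : ℝ => (1 + t) * Real.log (1 + t) :=
      Real.continuous_mul_log.comp (continuous_const.add continuous_id)
    have h2 : Continuous fun t : ℝ => (1 - t) * Real.log (1 - t) :=
      Real.continuous_mul_log.comp (continuous_const.sub continuous_id)
    exact (continuous_const.mul (continuous_pow 2)).sub (h1.add h2)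
  have hD0 : D 0 = 0 := by simp [D]
  have hDone : D 1 = 0 := by simp [D]; ring
  have hD1z : D1 0 = 0 := by simp [D1]
  -- the inflection point
  set ts : ℝ := Real.sqrt (1 - 1 / (2 * Real.log 2)) with hts
  have hkey : 4 * Real.log 2 * (1 / (2 * Real.log 2)) = 2 := by field_simp; ring
  have hinner : 0 < 1 - 1 / (2 * Real.log 2) := by
    rw [sub_pos, div_lt_one (by positivity)]
    linarith
  have hts_sq : ts ^ 2 = 1 - 1 / (2 * Real.log 2) := Real.sq_sqrt hinner.le
  have hts0 : 0 < ts := Real.sqrt_pos.2 hinner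
  have hts1 : ts < 1 := by
    rw [hts, Real.sqrt_lt' one_pos]
    have : 0 < 1 / (2 * Real.log 2) := by positivity
    linarith
  -- sign of the second derivative
  have hD2 : ∀ x : ℝ, -1 < x → x < 1 →
      D2 x = (4 * Real.log 2 * (1 - x ^ 2) - 2) / (1 - x ^ 2) := by
    intro x hx1 hx2
    have hpos1 : (0 : ℝ) < 1 + x := by linarith
    have hpos2 : (0 : ℝ) < 1 - x := by linarith
    have : (1 : ℝ) - x ^ 2 = (1 + x) * (1 - x) := by ring
    simp only [D2, this]
    field_simp
    ring
  have hD2_nonneg : ∀ x ∈ Ioo 0 ts, 0 ≤ D2 x := by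
    intro x hx
    have hx1 : x < 1 := hx.2.trans hts1
    have hxsq : x ^ 2 ≤ ts ^ 2 := by
      gcongr
      · linarith [hx.1]
      · exact hx.2.le
    rw [hD2 x (by linarith [hx.1]) hx1]
    refine div_nonneg ?_ (by nlinarith)
    rw [hts_sq] at hxsq
    nlinarith
  have hD2_nonpos : ∀ x ∈ Ioo ts 1, D2 x ≤ 0 := by
    intro x hx
    have hxsq : ts ^ 2 ≤ x ^ 2 := by
      gcongr
      exact hx.1.le
    rw [hD2 x (by linarith [hx.1, hts0]) hx.2]
    refine div_nonpos_of_nonpos_of_nonneg ?_ (by nlinarith [hx.2, hx.1, hts0])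
    rw [hts_sq] at hxsq
    nlinarith [hx.2]
  -- Part A: convex on [0, t*], above the (vanishing) tangent at 0
  have hconv : ConvexOn ℝ (Icc 0 ts) D := by
    refine convexOn_of_hasDerivWithinAt2_nonneg (convex_Icc 0 ts) hcont.continuousOn
      (f' := D1) (f'' := D2) ?_ ?_ ?_
    · intro x hx
      rw [interior_Icc] at hx
      exact (hderiv x (by linarith [hx.1]) (hx.2.trans hts1)).hasDerivWithinAt
    · intro x hx
      rw [interior_Icc] at hx
      exact (hderiv2 x (by linarith [hx.1]) (hx.2.trans hts1)).hasDerivWithinAt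
    · intro x hx
      rw [interior_Icc] at hx
      exact hD2_nonneg x hx
  have hA : ∀ x ∈ Icc 0 ts, 0 ≤ D x := by
    intro x hx
    rcases eq_or_lt_of_le hx.1 with h | h
    · rw [← h, hD0]
    · have hsl := hconv.le_slope_of_hasDerivAt (x := 0) (y := x) ⟨le_rfl, hts0.le⟩ hx h
        (hderiv 0 (by norm_num) (by norm_num))
      rw [hD1z, slope_def_field, hD0, sub_zero, sub_zero] at hsl
      exact (div_nonneg_iff.1 hsl).elim (fun h' => h'.1)
        fun h' => absurd h'.2 (not_le.2 h)
  -- Part B: concave on [t*, 1], above the minimum of the endpoint values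
  have hconc : ConcaveOn ℝ (Icc ts 1) D := by
    refine concaveOn_of_hasDerivWithinAt2_nonpos (convex_Icc ts 1) hcont.continuousOn
      (f' := D1) (f'' := D2) ?_ ?_ ?_
    · intro x hx
      rw [interior_Icc] at hx
      exact (hderiv x (by linarith [hx.1, hts0]) hx.2).hasDerivWithinAt
    · intro x hx
      rw [interior_Icc] at hx
      exact (hderiv2 x (by linarith [hx.1, hts0]) hx.2).hasDerivWithinAt
    · intro x hx
      rw [interior_Icc] at hx
      exact hD2_nonpos x hx
  have hB : ∀ x ∈ Icc ts 1, 0 ≤ D x := by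
    intro x hx
    have hmin := hconc.min_le_of_mem_Icc (x := ts) (y := 1) ⟨le_rfl, hts1.le⟩ ⟨hts1.le, le_rfl⟩ hx
    have hts_nonneg : 0 ≤ D ts := hA ts ⟨hts0.le, le_rfl⟩
    rw [hDone] at hmin
    exact le_trans (le_min hts_nonneg le_rfl) hmin
  -- conclusion
  rcases le_or_gt t ts with h | h
  · exact hA t ⟨h0, h⟩
  · exact hB t ⟨h.le, h1⟩

/-- **`h(p) ≥ 4 p (1 − p)` (bits)**: `4 log 2 · p (1 − p) ≤ binEntropy p` for `p ∈ [0, 1]`, with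
equality exactly at `p ∈ {0, 1/2, 1}`.  By symmetry `p ≤ 1/2`; substitute `t = 1 − 2p` in
`polarAux_nonneg`. [cite: Arikan2010, Prop. 2 (proof: Z(X|Y)² ≤ H(X|Y))] -/
theorem four_mul_log_two_mul_le_binEntropy {p : ℝ} (hp0 : 0 ≤ p) (hp1 : p ≤ 1) :
    4 * Real.log 2 * (p * (1 - p)) ≤ Real.binEntropy p := by
  wlog hp : p ≤ 1 / 2 generalizing p
  · have h := this (p := 1 - p) (by linarith) (by linarith) (by linarith)
    rw [Real.binEntropy_one_sub] at h
    nlinarith [h]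
  rcases eq_or_lt_of_le hp0 with h | h
  · subst h
    simp
  have key := polarAux_nonneg (t := 1 - 2 * p) (by linarith) (by linarith)
  have e1 : (1 : ℝ) + (1 - 2 * p) = 2 * (1 - p) := by ring
  have e2 : (1 : ℝ) - (1 - 2 * p) = 2 * p := by ring
  rw [e1, e2, Real.log_mul two_ne_zero (by linarith : (1 : ℝ) - p ≠ 0),
    Real.log_mul two_ne_zero h.ne'] at key
  unfold Real.binEntropy
  rw [Real.log_inv, Real.log_inv]
  nlinarith [key]

/-! ### The un-normalised binary entropy of a pair of counts -/

/-- `pairEnt` through Mathlib's `binEntropy` (nats): for `a, b ≥ 0` with `a + b > 0`,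
`pairEnt a b = (a + b) · binEntropy (a/(a+b)) / log 2`. [folklore] -/
theorem pairEnt_eq_binEntropy {a b : ℝ} (hab : 0 < a + b) :
    pairEnt a b = (a + b) * Real.binEntropy (a / (a + b)) / Real.log 2 := by
  unfold pairEnt Real.binEntropy Real.logb
  have e3 : 1 - a / (a + b) = b / (a + b) := by field_simp; ring
  rw [e3, inv_div, inv_div]
  field_simp

/-- `pairEnt 0 b = 0` and `pairEnt a 0 = 0`: a deterministic pair has no entropy. [folklore] -/
theorem pairEnt_zero_left (b : ℝ) : pairEnt 0 b = 0 := by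
  rcases eq_or_ne b 0 with rfl | hb
  · simp [pairEnt]
  · simp [pairEnt, div_self hb]

/-- `pairEnt a 0 = 0`. [folklore] -/
theorem pairEnt_zero_right (a : ℝ) : pairEnt a 0 = 0 := by
  rcases eq_or_ne a 0 with rfl | ha
  · simp [pairEnt]
  · simp [pairEnt, div_self ha]

/-- `pairEnt a b ≥ 0` for nonnegative counts. [folklore] -/
theorem pairEnt_nonneg {a b : ℝ} (ha : 0 ≤ a) (hb : 0 ≤ b) : 0 ≤ pairEnt a b := by
  rcases eq_or_lt_of_le (add_nonneg ha hb) with h | h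
  · have ha0 : a = 0 := by linarith
    rw [ha0, pairEnt_zero_left]
  rw [pairEnt_eq_binEntropy h]
  refine div_nonneg (mul_nonneg h.le (Real.binEntropy_nonneg (div_nonneg ha h.le) ?_))
    (Real.log_nonneg one_le_two)
  rw [div_le_one h]
  linarith

/-- **`Z² ≤ H` pointwise**: `4ab/(a+b) ≤ pairEnt a b` for `a, b ≥ 0`, i.e.
`(a+b) · (2√(p(1−p)))² ≤ (a+b) · h₂(p)` with `p = a/(a+b)`. [cite: Arikan2010, Prop. 2 (Z(X|Y)² ≤ H(X|Y))] -/
theorem four_mul_div_le_pairEnt {a b : ℝ} (ha : 0 ≤ a) (hb : 0 ≤ b) :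
    4 * a * b / (a + b) ≤ pairEnt a b := by
  rcases eq_or_lt_of_le (add_nonneg ha hb) with h | h
  · have ha0 : a = 0 := by linarith
    rw [ha0, pairEnt_zero_left]
    simp
  have hc0 : 0 < Real.log 2 := Real.log_pos one_lt_two
  have hp := four_mul_log_two_mul_le_binEntropy (p := a / (a + b)) (div_nonneg ha h.le)
    (by rw [div_le_one h]; linarith)
  rw [pairEnt_eq_binEntropy h, le_div_iff₀ hc0]
  calc 4 * a * b / (a + b) * Real.log 2
      = (a + b) * (4 * Real.log 2 * (a / (a + b) * (1 - a / (a + b)))) := by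
        field_simp
        ring
    _ ≤ (a + b) * Real.binEntropy (a / (a + b)) := mul_le_mul_of_nonneg_left hp h.le

/-- **`H ≤ log₂(1 + Z)` pointwise**: `pairEnt a b ≤ (a + b) log₂(1 + 2√(ab)/(a+b))` for
`a, b ≥ 0`, `a + b > 0`, i.e. `h₂(p) ≤ log₂(1 + 2√(p(1−p))) = 2 log₂(√p + √(1−p))` (Shannon
entropy is at most the Rényi entropy of order `1/2`): two-point Jensen for the concave `log` at
`√((a+b)/a)`, `√((a+b)/b)` with weights `a/(a+b)`, `b/(a+b)`.
[cite: Arikan2010, Prop. 2 (H(X|Y) ≤ log(1 + Z(X|Y)))] -/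
theorem pairEnt_le_mul_logb {a b : ℝ} (ha : 0 ≤ a) (hb : 0 ≤ b) (hab : 0 < a + b) :
    pairEnt a b ≤ (a + b) * Real.logb 2 (1 + 2 * Real.sqrt (a * b) / (a + b)) := by
  have hc0 : 0 < Real.log 2 := Real.log_pos one_lt_two
  -- degenerate cases
  rcases eq_or_lt_of_le ha with h0 | ha'
  · rw [← h0, pairEnt_zero_left]
    simp
  rcases eq_or_lt_of_le hb with h0 | hb'
  · rw [← h0, pairEnt_zero_right]
    simp
  have hw : a / (a + b) + b / (a + b) = 1 := by field_simp
  -- two-point Jensen for `log` at `√((a+b)/a)`, `√((a+b)/b)` with weights `a/(a+b)`, `b/(a+b)`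
  have hJ := (strictConcaveOn_log_Ioi).concaveOn.2
    (Set.mem_Ioi.2 (Real.sqrt_pos.2 (div_pos hab ha')))
    (Set.mem_Ioi.2 (Real.sqrt_pos.2 (div_pos hab hb')))
    (div_nonneg ha hab.le) (div_nonneg hb hab.le) hw
  simp only [smul_eq_mul] at hJ
  rw [Real.log_sqrt (div_nonneg hab.le ha), Real.log_sqrt (div_nonneg hab.le hb)] at hJ
  -- the Jensen point is `√(a/(a+b)) + √(b/(a+b))`
  have hpa : a / (a + b) * Real.sqrt ((a + b) / a) = Real.sqrt (a / (a + b)) := by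
    symm
    rw [Real.sqrt_eq_iff_mul_self_eq_of_pos (by positivity)]
    have h1 : Real.sqrt ((a + b) / a) * Real.sqrt ((a + b) / a) = (a + b) / a :=
      Real.mul_self_sqrt (by positivity)
    calc a / (a + b) * Real.sqrt ((a + b) / a) * (a / (a + b) * Real.sqrt ((a + b) / a))
        = (a / (a + b)) ^ 2 * (Real.sqrt ((a + b) / a) * Real.sqrt ((a + b) / a)) := by ring
      _ = a / (a + b) := by
          rw [h1]
          field_simp
  have hpb : b / (a + b) * Real.sqrt ((a + b) / b) = Real.sqrt (b / (a + b)) := by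
    symm
    rw [Real.sqrt_eq_iff_mul_self_eq_of_pos (by positivity)]
    have h1 : Real.sqrt ((a + b) / b) * Real.sqrt ((a + b) / b) = (a + b) / b :=
      Real.mul_self_sqrt (by positivity)
    calc b / (a + b) * Real.sqrt ((a + b) / b) * (b / (a + b) * Real.sqrt ((a + b) / b))
        = (b / (a + b)) ^ 2 * (Real.sqrt ((a + b) / b) * Real.sqrt ((a + b) / b)) := by ring
      _ = b / (a + b) := by
          rw [h1]
          field_simp
  rw [hpa, hpb] at hJ
  -- and its square is `1 + 2√(ab)/(a+b)`
  have hprod : Real.sqrt (a * b) =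
      (a + b) * (Real.sqrt (a / (a + b)) * Real.sqrt (b / (a + b))) := by
    rw [Real.sqrt_eq_iff_mul_self_eq_of_pos (by positivity)]
    have h1 : Real.sqrt (a / (a + b)) * Real.sqrt (a / (a + b)) = a / (a + b) :=
      Real.mul_self_sqrt (by positivity)
    have h2 : Real.sqrt (b / (a + b)) * Real.sqrt (b / (a + b)) = b / (a + b) :=
      Real.mul_self_sqrt (by positivity)
    calc (a + b) * (Real.sqrt (a / (a + b)) * Real.sqrt (b / (a + b))) *
          ((a + b) * (Real.sqrt (a / (a + b)) * Real.sqrt (b / (a + b))))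
        = (a + b) ^ 2 * (Real.sqrt (a / (a + b)) * Real.sqrt (a / (a + b))) *
            (Real.sqrt (b / (a + b)) * Real.sqrt (b / (a + b))) := by ring
      _ = a * b := by
          rw [h1, h2]
          field_simp
  have hsq : (Real.sqrt (a / (a + b)) + Real.sqrt (b / (a + b))) ^ 2 =
      1 + 2 * Real.sqrt (a * b) / (a + b) := by
    rw [add_sq, Real.sq_sqrt (div_nonneg ha hab.le), Real.sq_sqrt (div_nonneg hb hab.le), hprod]
    field_simp
    ring
  have hlog2 : Real.log (1 + 2 * Real.sqrt (a * b) / (a + b)) =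
      2 * Real.log (Real.sqrt (a / (a + b)) + Real.sqrt (b / (a + b))) := by
    rw [← hsq, Real.log_pow]
    rfl
  -- assemble
  unfold pairEnt Real.logb
  rw [hlog2]
  have h2 : a * (Real.log ((a + b) / a) / Real.log 2) + b * (Real.log ((a + b) / b) / Real.log 2) =
      (2 * (a + b) / Real.log 2) *
        (a / (a + b) * (Real.log ((a + b) / a) / 2) + b / (a + b) * (Real.log ((a + b) / b) / 2)) := by
    field_simp
  rw [h2, show (a + b) * (2 * Real.log (Real.sqrt (a / (a + b)) + Real.sqrt (b / (a + b))) /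
      Real.log 2) = (2 * (a + b) / Real.log 2) *
        Real.log (Real.sqrt (a / (a + b)) + Real.sqrt (b / (a + b))) by ring]
  exact mul_le_mul_of_nonneg_left hJ (by positivity)

/-- **`H ≤ 1` pointwise**: `pairEnt a b ≤ a + b` for `a, b ≥ 0` (`h₂ ≤ 1` bit), from
`pairEnt_le_mul_logb` and AM–GM `2√(ab) ≤ a + b`. [cite: CoverThomas2006, Thm 2.6.4 (H ≤ log |𝒳|)] -/
theorem pairEnt_le_add {a b : ℝ} (ha : 0 ≤ a) (hb : 0 ≤ b) : pairEnt a b ≤ a + b := by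
  rcases eq_or_lt_of_le (add_nonneg ha hb) with h | h
  · have ha0 : a = 0 := by linarith
    have hb0 : b = 0 := by linarith
    rw [ha0, hb0, pairEnt_zero_left]
    simp
  refine (pairEnt_le_mul_logb ha hb h).trans ?_
  have hamgm : 2 * Real.sqrt (a * b) ≤ a + b := by
    have := Real.sqrt_le_iff.2 (show 0 ≤ (a + b) / 2 ∧ a * b ≤ ((a + b) / 2) ^ 2 from
      ⟨by positivity, by nlinarith [sq_nonneg (a - b)]⟩)
    linarith
  have hle : Real.logb 2 (1 + 2 * Real.sqrt (a * b) / (a + b)) ≤ 1 := by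
    rw [Real.logb_le_iff_le_rpow one_lt_two (by positivity), Real.rpow_one]
    have := (div_le_one h).2 hamgm
    linarith
  calc (a + b) * Real.logb 2 (1 + 2 * Real.sqrt (a * b) / (a + b)) ≤ (a + b) * 1 :=
        mul_le_mul_of_nonneg_left hle h.le
    _ = a + b := mul_one _

end Literature.InformationTheory.Coding.Polar

end
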